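import Literature.Probability.FitznerVanDerHofstad2017.SrwChatPowSchwinger
import Literature.Probability.FitznerVanDerHofstad2017.SrwLawBesselEGF
import HarnessLib

/-!
# The untwisted one-coordinate transforms in closed Bessel-`I` form

d-free identities for the `β = 0` blocks of the axis-atom double integrals
(`SrwChatPowSchwinger` Part II, `SrwAxisAtomDoubleIntegral`, `SrwTwoCosineInsertion`):
with `μI` = Lebesgue measure on `[-π, π]` and `I_n` = `Literature.Probability.LatticeModels.besselI`
(integer order, power-series definition; integral form `besselI_eq_integral_cosh`),

* `integral_cos_mul_exp_mul_cos_muI` — `∫ cos(n t) e^{u cos t} dμI = 2π I_n(u)` (real), and its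
  complex form `integral_ofReal_cos_mul_cexp_muI`;
* `integral_cexp_muI_eq_besselI_zero` — `B₀(u) = ∫ e^{u cos t} dμI = 2π I₀(u)`;
* `integral_cos_mul_cexp_muI_eq_besselI_one` — `C₁⁰(u) = ∫ cos t · e^{u cos t} dμI = 2π I₁(u)`;
* `integral_cos_sq_mul_cexp_muI_eq` — `C₂⁰(u) = ∫ cos² t · e^{u cos t} dμI = π (I₀(u) + I₂(u))`;
* `norm_integral_cos_pow_mul_cexp_muI_le` — `‖∫ cos^j t · e^{u cos t + iβ cos(m t)} dμI‖ ≤ 2π I₀(u)`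
  for all `β`, `m`, `j` (the twisted factors `B, C₁, C₂` are dominated by `B₀`).

So the `β = 0` term of `srwK_succ_zero_single_eq_integral_axisTransform` is `(2π I₀(τ/d))^d`, and the
`β = 0` block `F(τ,0)` of `srwK_succ_two_single_eq_integral_axisTransform` is
`d·π(I₀+I₂)(2πI₀)^{d-1} + d(d-1)(2πI₁)²(2πI₀)^{d-2}` at `u = τ/d` — closed forms the numerics seats
can evaluate with the tree's `I_n` bounds (`BesselIDebyeAsymptotics`, `SrwLawBesselEGF`).
Source for `I_n(u) = π⁻¹∫₀^π e^{u cos θ} cos(nθ) dθ`: DLMF 10.32.3.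
-/

noncomputable section

open MeasureTheory Set Filter Real Finset
open scoped Topology Nat

namespace Literature.Probability.FitznerVanDerHofstad2017

open Literature.Barriers.CriticalPhenomena
open Literature.Barriers.CriticalPhenomena.Slade2006Prop53 (μI P)
open Literature.Probability.LatticeModels (besselI besselI_eq_integral_cosh)

/-- `∫_{[-π,π]} cos(n t) e^{u cos t} dt = 2π I_n(u)`. [cite: DLMF, 10.32.3] -/
theorem integral_cos_mul_exp_mul_cos_muI (u : ℝ) (n : ℤ) :
    ∫ t, Real.cos (n * t) * Real.exp (u * Real.cos t) ∂μI = 2 * π * besselI n u := by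
  have hI := besselI_eq_integral_cosh u 0 n
  simp only [Real.cosh_zero, Real.sinh_zero, mul_one, mul_zero, zero_mul, zero_sub, Real.cos_neg,
    neg_zero, Real.exp_zero] at hI
  have hπ : (0:ℝ) < 2 * π := by positivity
  rw [hI, show μI = volume.restrict (Icc (-π) π) from rfl, integral_Icc_eq_integral_Ioc,
    ← intervalIntegral.integral_of_le (by linarith [Real.pi_pos] : -π ≤ π)]
  rw [show (fun t => Real.cos (n * t) * Real.exp (u * Real.cos t))
      = fun t => Real.exp (u * Real.cos t) * Real.cos (n * t) from funext fun t => mul_comm _ _]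
  field_simp

/-- Complex form: `∫ ↑(cos(n t)) · e^{↑(u cos t)} dμI = ↑(2π I_n(u))`. [cite: DLMF, 10.32.3] -/
theorem integral_ofReal_cos_mul_cexp_muI (u : ℝ) (n : ℤ) :
    ∫ t, ((Real.cos (n * t) : ℝ) : ℂ) * Complex.exp (((u * Real.cos t : ℝ) : ℂ)) ∂μI
      = ((2 * π * besselI n u : ℝ) : ℂ) := by
  rw [← integral_cos_mul_exp_mul_cos_muI, ← integral_complex_ofReal]
  refine integral_congr_ae (ae_of_all _ fun t => ?_)
  push_cast
  rfl

/-- `B₀(u) = ∫ e^{↑(u cos t)} dμI = ↑(2π I₀(u))`. [cite: DLMF, 10.32.1] -/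
theorem integral_cexp_muI_eq_besselI_zero (u : ℝ) :
    ∫ t, Complex.exp (((u * Real.cos t : ℝ) : ℂ)) ∂μI = ((2 * π * besselI 0 u : ℝ) : ℂ) := by
  rw [← integral_ofReal_cos_mul_cexp_muI u 0]
  refine integral_congr_ae (ae_of_all _ fun t => ?_)
  simp

/-- `C₁⁰(u) = ∫ ↑(cos t) e^{↑(u cos t)} dμI = ↑(2π I₁(u))`. [cite: DLMF, 10.32.3] -/
theorem integral_cos_mul_cexp_muI_eq_besselI_one (u : ℝ) :
    ∫ t, ((Real.cos t : ℝ) : ℂ) * Complex.exp (((u * Real.cos t : ℝ) : ℂ)) ∂μI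
      = ((2 * π * besselI 1 u : ℝ) : ℂ) := by
  rw [← integral_ofReal_cos_mul_cexp_muI u 1]
  refine integral_congr_ae (ae_of_all _ fun t => ?_)
  simp

/-- `C₂⁰(u) = ∫ ↑(cos² t) e^{↑(u cos t)} dμI = ↑(π (I₀(u) + I₂(u)))` (`cos² = (1 + cos 2t)/2`).
[cite: DLMF, 10.32.3] -/
theorem integral_cos_sq_mul_cexp_muI_eq (u : ℝ) :
    ∫ t, ((Real.cos t ^ 2 : ℝ) : ℂ) * Complex.exp (((u * Real.cos t : ℝ) : ℂ)) ∂μI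
      = ((π * (besselI 0 u + besselI 2 u) : ℝ) : ℂ) := by
  have h0 := integral_ofReal_cos_mul_cexp_muI u 0
  have h2 := integral_ofReal_cos_mul_cexp_muI u 2
  have hc : Continuous fun t : ℝ => Complex.exp (((u * Real.cos t : ℝ) : ℂ)) := by fun_prop
  have hint : ∀ n : ℤ, Integrable (fun t : ℝ => ((Real.cos (n * t) : ℝ) : ℂ)
      * Complex.exp (((u * Real.cos t : ℝ) : ℂ))) μI := by
    intro n
    have : IsFiniteMeasure μI := by
      rw [show μI = volume.restrict (Icc (-π) π) from rfl]; infer_instance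
    refine (integrable_const (Real.exp |u|)).mono' (Continuous.aestronglyMeasurable (by fun_prop))
      (ae_of_all _ fun t => ?_)
    rw [norm_mul, Complex.norm_real, Complex.norm_exp, Complex.ofReal_re, Real.norm_eq_abs]
    calc |Real.cos (n * t)| * Real.exp (u * Real.cos t) ≤ 1 * Real.exp |u| := by
          gcongr
          · exact Real.abs_cos_le_one _
          · exact (le_abs_self _).trans (by rw [abs_mul]; exact mul_le_of_le_one_right (abs_nonneg _) (Real.abs_cos_le_one _))
      _ = Real.exp |u| := one_mul _
  have e : ∀ t : ℝ, ((Real.cos t ^ 2 : ℝ) : ℂ) * Complex.exp (((u * Real.cos t : ℝ) : ℂ))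
      = (1/2 : ℂ) * (((Real.cos ((0:ℤ) * t) : ℝ) : ℂ) * Complex.exp (((u * Real.cos t : ℝ) : ℂ)))
        + (1/2 : ℂ) * (((Real.cos ((2:ℤ) * t) : ℝ) : ℂ) * Complex.exp (((u * Real.cos t : ℝ) : ℂ))) := by
    intro t
    have hsq : Real.cos t ^ 2 = 1/2 + Real.cos (2 * t) / 2 := by rw [Real.cos_sq t]
    rw [hsq]; push_cast; simp only [zero_mul, Complex.cos_zero]; ring
  simp_rw [e]
  rw [integral_add ((hint 0).const_mul _) ((hint 2).const_mul _), integral_const_mul, integral_const_mul,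
    h0, h2]
  push_cast; ring

/-- **Domination of the twisted transforms**: every twisted one-coordinate transform with `j` cosine
insertions is bounded in norm by the untwisted `B₀(u) = 2π I₀(u)`, uniformly in `β` and `m`
(`|cos^j| ≤ 1`, `|e^{iβ cos(mt)}| = 1`). [cite: DLMF, 10.32.1] -/
theorem norm_integral_cos_pow_mul_cexp_muI_le (u β : ℝ) (m : ℤ) (j : ℕ) :
    ‖∫ t, ((Real.cos t ^ j : ℝ) : ℂ)
        * Complex.exp (((u * Real.cos t : ℝ) : ℂ) + ((β * Real.cos (m * t) : ℝ) : ℂ) * Complex.I) ∂μI‖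
      ≤ 2 * π * besselI 0 u := by
  have h0 := integral_cos_mul_exp_mul_cos_muI u 0
  simp only [Int.cast_zero, zero_mul, Real.cos_zero, one_mul] at h0
  rw [← h0]
  refine (norm_integral_le_integral_norm _).trans (integral_mono_of_nonneg (ae_of_all _ fun t => norm_nonneg _) ?_ (ae_of_all _ fun t => ?_))
  · have : IsFiniteMeasure μI := by
      rw [show μI = volume.restrict (Icc (-π) π) from rfl]; infer_instance
    exact (integrable_const (Real.exp |u|)).mono' (Continuous.aestronglyMeasurable (by fun_prop))
      (ae_of_all _ fun t => by
        rw [Real.norm_eq_abs, Real.abs_exp]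
        exact Real.exp_le_exp.2 ((le_abs_self _).trans (by
          rw [abs_mul]; exact mul_le_of_le_one_right (abs_nonneg _) (Real.abs_cos_le_one _))))
  · simp only
    rw [norm_mul, Complex.norm_real, Complex.norm_exp, Complex.add_re, Complex.ofReal_re,
      Complex.re_ofReal_mul, Complex.I_re, mul_zero, add_zero, Real.norm_eq_abs, abs_pow]
    calc |Real.cos t| ^ j * Real.exp (u * Real.cos t) ≤ 1 ^ j * Real.exp (u * Real.cos t) := by
          gcongr; exact Real.abs_cos_le_one t
      _ = Real.exp (u * Real.cos t) := by rw [one_pow, one_mul]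

end Literature.Probability.FitznerVanDerHofstad2017

end
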